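import Summits.NavierStokesRegularity.OSWSelfSimilar.SheetRCertificateAssembly
import Summits.NavierStokesRegularity.OSWSelfSimilar.SheetREvenEnergyClass
import Summits.NavierStokesRegularity.OSWSelfSimilar.SheetREvenForms
import HarnessLib

/-!
# SHEET-ℝ frame, EVEN ZERO-MASS class `E⁺₀`: the sheet's CONCRETE even operators, part 1 — the nonlocal part `P⁺` of `DG⁺(Ω̄)` with the
# translation-COVARIANT velocity as a BOUNDED OPERATOR `PopE : EspE L hL →L[ℝ] W L`

HONEST FRAMING (cell ns-blowup GROUP B / zone Z3, case Z3-SR-SPEC EVEN half; DESIGN-Z3-SR-SPEC-EVEN (D1)/(D2)/(D4); 1-D MODEL certificate frame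
(viscous gCLM/OSW sheet on the line); not Euler/NS; «violates: none — MODEL»).  Nothing here asserts that a profile exists; no number of record moves.
selfsim g14's even resolvent dictionary (`GardingDataKE`, `resolventEven`, `generatorEven`, `evansEven`) is keyed on an ARBITRARY bounded real
`K : EspE L hL →L[ℝ] W L`; cert-2 g10's even point records (`PointDataE`) on an abstract pseudo-resolvent.  THIS FILE supplies the sheet's own `K`,
the even twin of selfsim g10's `SheetRAssemblyOperators` (`Pop`, `Qop`) on cert-1 g8's even function-level bounds (`SheetREvenEnergyClass`):

* §1 `profileE_of_mem` / `basicE_of_mem` / `hilbertE_of_mem` / `covariantVelocityE_of_mem` — the profile `δ = profile p` of `p ∈ EspE` (even, zero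
  mass, `∫w(δ′² + ¼δ²) = ‖p‖²`), `‖Hδ‖_w = ‖δ‖_w` (cert-1 `weightedSq_hilbertTransform_of_primitive_zeroMass`), and the COVARIANT velocity
  `𝒰⁺δ(ξ) = ∫_{(−∞,ξ]} Hδ` (DESIGN (D2)): continuous, `|𝒰⁺δ| ≤ (π/(4L))^{1/2}‖δ‖_w` (cert-1 `abs_covariantVelocity_le`), additive and homogeneous in `p`;
* §2 **`PopE`** `: EspE L hL →L[ℝ] W L`, `p ↦ λχ·δ + Ω̄·Hδ − a·Ω̄₁·𝒰⁺δ` — the nonlocal part of the even linearisation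
  `DG⁺(Ω̄)δ = δ + ½ξδ′ + a(𝒰⁺δ·Ω̄′ + 𝒰Ω̄·δ′) − Hδ·Ω̄ − HΩ̄·δ − δ″ = (B_λ − P⁺)δ` (`B_λ = −∂² + d∂ + V`, `d = drift a Ω̄`, `V = potential L λ Ω̄` of
  `SheetRCertificateAssembly`), bounded by `2(|λ| + sup|Ω̄| + |a|(π/(4L))^{1/2}‖Ω̄₁‖_w)`; `PopCE` = `PopE` at a centre `IsCentre L Ω̄ Ω̄₁ H₀`;
* the second variation `B⁺_u = DG⁺(Ω̄ + u) − DG⁺(Ω̄)` and its bound `‖B⁺_u‖ ≤ Δ⁺/2` on the certified ball are the companion file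
  `SheetREvenSecondVariation` (part 2; split by the ≤ 400-line rule).
Two definitions with body (`PopE`, `PopCE`; function avatar `PopEFun`); no named fact, no `Prop` hypothesis.
WHAT THIS IS NOT: not NS; not the spectral certificate; no interval arithmetic.
-/

noncomputable section

namespace Summit.NavierStokesRegularity.OSWSelfSimilar
namespace SheetREvenAssemblyOperators

open _root_.MeasureTheory _root_.Set _root_.Filter _root_.Real Literature.Analysis.Fourier SheetRWeakProfilePV SheetRWeakToStrong
  SheetREnergyClass SheetRWeightedMeasure SheetRWeightedEmbeddings SheetREnergySpace SheetRSolutionOperator SheetRWeakPairingExpansion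
  SheetRAssemblyOperators SheetRCertificateAssembly SheetREvenTests SheetREvenEnergySpace SheetREvenForms SheetREvenEnergyClass
open scoped Topology ENNReal

/-! ### §1 The profile of an even energy-space element, its Hilbert transform and its covariant velocity -/

section Profile

variable {L : ℝ} (hL : 0 < L)

/-- The profile `δ = profile p` of `p ∈ EspE` in primitive form with derivative `derE p`, even, with its weights, ZERO MASS, and
`∫ w (δ′² + ¼δ²) = ‖p‖²`. [folklore] -/
theorem profileE_of_mem (p : EspE L hL) :
    (∀ x, profile p x = profile p 0 + ∫ s in (0 : ℝ)..x, derE p s) ∧ (∀ y, profile p (-y) = profile p y) ∧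
    AEStronglyMeasurable (derE p) volume ∧ Integrable (fun y => (L ^ 2 + y ^ 2) * profile p y ^ 2) ∧
    Integrable (fun y => (L ^ 2 + y ^ 2) * derE p y ^ 2) ∧ (∫ y, profile p y = 0) ∧
    (∫ y, (L ^ 2 + y ^ 2) * (derE p y ^ 2 + 1 / 4 * profile p y ^ 2)) = ‖p‖ ^ 2 := by
  obtain ⟨hu, hev, hm, h0, h1, e0, e1, hz⟩ := energyClassE_of_mem hL p
  refine ⟨hu, hev, hm, h0, h1, hz, ?_⟩
  have hn : ‖p‖ = ‖((p : EspE L hL) : WithLp 2 (W L × W L))‖ := rfl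
  have hsplit : ∫ y, (L ^ 2 + y ^ 2) * (derE p y ^ 2 + 1 / 4 * profile p y ^ 2)
      = (∫ y, (L ^ 2 + y ^ 2) * derE p y ^ 2) + 1 / 4 * ∫ y, (L ^ 2 + y ^ 2) * profile p y ^ 2 := by
    rw [← integral_const_mul, ← integral_add h1 (h0.const_mul _)]
    exact integral_congr_ae (Eventually.of_forall fun y => by ring)
  rw [hsplit, derE_def, e0, e1, hn, WithLp.prod_norm_sq_eq_of_L2]
  ring

/-- `(∫ w (δ′² + ¼δ²))^{1/2} = ‖p‖`. [folklore] -/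
theorem sqrt_energyE_eq_norm (p : EspE L hL) :
    Real.sqrt (∫ y, (L ^ 2 + y ^ 2) * (derE p y ^ 2 + 1 / 4 * profile p y ^ 2)) = ‖p‖ := by
  rw [(profileE_of_mem hL p).2.2.2.2.2.2, Real.sqrt_sq (norm_nonneg _)]

/-- The profile is continuous, `L¹ ∩ L²`, with `δ′ ∈ L²`. [folklore] -/
theorem basicE_of_mem (p : EspE L hL) :
    Continuous (profile p) ∧ MemLp (derE p) 2 volume ∧ Integrable (profile p) ∧ MemLp (profile p) 2 volume := by
  obtain ⟨hu, -, hm, h0, h1, -, -⟩ := profileE_of_mem hL p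
  obtain ⟨hc, h2, h3, h4, -⟩ := basic_of_primitive hL hu hm h0 h1
  exact ⟨hc, h2, h4, h3⟩

/-- **`‖Hδ‖_w = ‖δ‖_w` on `E⁺₀`** (zero mass; cert-1's parity-free isometry): `Hδ` a.e.-strongly measurable, in `L¹`, `(L²+y²)(Hδ)² ∈ L¹`,
`∫(L²+y²)(Hδ)² = ∫(L²+y²)δ²`. [folklore] -/
theorem hilbertE_of_mem (p : EspE L hL) :
    AEStronglyMeasurable (hilbertTransform (profile p)) volume ∧ Integrable (hilbertTransform (profile p)) ∧
      Integrable (fun y => (L ^ 2 + y ^ 2) * hilbertTransform (profile p) y ^ 2) ∧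
      ∫ y, (L ^ 2 + y ^ 2) * hilbertTransform (profile p) y ^ 2 = ∫ y, (L ^ 2 + y ^ 2) * profile p y ^ 2 := by
  obtain ⟨hu, -, hm, h0, h1, hz, -⟩ := profileE_of_mem hL p
  obtain ⟨hHm, hwH, hiso⟩ := weightedSq_hilbertTransform_of_primitive_zeroMass hL hu hm h0 h1 hz
  exact ⟨hHm, integrable_of_weighted_sq hL hHm hwH, hwH, hiso⟩

/-- **The covariant velocity `𝒰⁺δ(ξ) = ∫_{(−∞,ξ]} Hδ` on `E⁺₀`**: continuous in `ξ`, and `|𝒰⁺δ(ξ)| ≤ (π/(4L))^{1/2}·(∫(L²+y²)δ²)^{1/2}` at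
every `ξ` (cert-1's `abs_covariantVelocity_le`). [folklore] -/
theorem covariantVelocityE_of_mem (p : EspE L hL) :
    (Continuous fun ξ => ∫ s in Iic ξ, hilbertTransform (profile p) s) ∧
      ∀ ξ, |∫ s in Iic ξ, hilbertTransform (profile p) s| ≤ Real.sqrt (π / (4 * L)) * Real.sqrt (∫ y, (L ^ 2 + y ^ 2) * profile p y ^ 2) := by
  obtain ⟨hu, hev, hm, h0, h1, hz, -⟩ := profileE_of_mem hL p
  exact ⟨(covariantVelocity_eq_const_add hL hu hm h0 h1 hz).2, fun ξ => abs_covariantVelocity_le hL hu hev hm h0 h1 hz ξ⟩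

/-- Additivity of `H` and `𝒰⁺` on `E⁺₀`, pointwise. [folklore] -/
theorem hilbertE_add (p q : EspE L hL) (ξ : ℝ) :
    hilbertTransform (profile (p + q)) ξ = hilbertTransform (profile p) ξ + hilbertTransform (profile q) ξ ∧
      ∫ s in Iic ξ, hilbertTransform (profile (p + q)) s =
        (∫ s in Iic ξ, hilbertTransform (profile p) s) + ∫ s in Iic ξ, hilbertTransform (profile q) s := by
  obtain ⟨hu, -, -, -, -, -, -⟩ := profileE_of_mem hL p
  obtain ⟨-, hu₁2, hui, -⟩ := basicE_of_mem hL p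
  obtain ⟨hv, -, -, -, -, -, -⟩ := profileE_of_mem hL q
  obtain ⟨-, hv₁2, hvi, -⟩ := basicE_of_mem hL q
  obtain ⟨-, hHpi, -, -⟩ := hilbertE_of_mem hL p
  obtain ⟨-, hHqi, -, -⟩ := hilbertE_of_mem hL q
  have hsum := (derE_add hL p q).2
  have hpt : ∀ x, hilbertTransform (profile (p + q)) x = hilbertTransform (profile p) x + hilbertTransform (profile q) x := fun x => by
    rw [hsum]; exact hilbertTransform_add_of_primitive hu hu₁2 hui hv hv₁2 hvi x
  refine ⟨hpt ξ, ?_⟩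
  rw [show (fun s => hilbertTransform (profile (p + q)) s) = fun s => hilbertTransform (profile p) s + hilbertTransform (profile q) s from
    funext hpt]
  exact integral_add hHpi.integrableOn hHqi.integrableOn

/-- Homogeneity of `H` and `𝒰⁺` on `E⁺₀`, pointwise. [folklore] -/
theorem hilbertE_smul (c : ℝ) (p : EspE L hL) (ξ : ℝ) :
    hilbertTransform (profile (c • p)) ξ = c * hilbertTransform (profile p) ξ ∧
      ∫ s in Iic ξ, hilbertTransform (profile (c • p)) s = c * ∫ s in Iic ξ, hilbertTransform (profile p) s := by
  have hprof := (derE_smul hL c p).2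
  have hH : hilbertTransform (profile (c • p)) = fun x => c * hilbertTransform (profile p) x := by
    rw [hprof]; exact funext fun x => hilbertTransform_const_mul c _ x
  refine ⟨by rw [hH], ?_⟩
  rw [hH, integral_const_mul]

end Profile

/-! ### §2 The nonlocal part `P⁺` of the even linearisation as a bounded operator `EspE L hL →L W L` -/

section PopE

variable {L : ℝ} (hL : 0 < L) (lam a : ℝ) {Ω Ω₁ : ℝ → ℝ} {B₀ : ℝ}
  (hΩm : AEStronglyMeasurable Ω volume) (hB₀ : 0 ≤ B₀) (hΩb : ∀ y, |Ω y| ≤ B₀)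
  (hΩ₁m : AEStronglyMeasurable Ω₁ volume) (hwΩ₁ : Integrable fun y => (L ^ 2 + y ^ 2) * Ω₁ y ^ 2)

/-- The function `P⁺δ = λχ·δ + Ω̄·Hδ − a·Ω̄₁·𝒰⁺δ` of the profile `δ = profile p` (`χ = L²/(L²+ξ²)`, `𝒰⁺δ = ∫_{(−∞,ξ]} Hδ` the COVARIANT
velocity of DESIGN-Z3-SR-SPEC-EVEN (D2)). [folklore] -/
def PopEFun (L lam a : ℝ) (Ω Ω₁ : ℝ → ℝ) {hL : 0 < L} (p : EspE L hL) (ξ : ℝ) : ℝ :=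
  lam * (L ^ 2 / (L ^ 2 + ξ ^ 2)) * profile p ξ + Ω ξ * hilbertTransform (profile p) ξ
    - a * Ω₁ ξ * ∫ s in Iic ξ, hilbertTransform (profile p) s

include hL hΩm hB₀ hΩb hΩ₁m hwΩ₁ in
/-- `P⁺δ ∈ L²(μ_w)` with `‖P⁺δ‖_w ≤ 2(|λ| + B₀ + |a|(π/(4L))^{1/2}‖Ω̄₁‖_w)·‖p‖` (`‖λχδ‖_w ≤ |λ|‖δ‖_w`, `‖Ω̄·Hδ‖_w ≤ B₀‖δ‖_w`,
`‖aΩ̄₁𝒰⁺δ‖_w ≤ |a|(π/(4L))^{1/2}‖δ‖_w‖Ω̄₁‖_w`, `‖δ‖_w ≤ 2‖p‖`). [folklore] -/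
theorem memLp_PopEFun (p : EspE L hL) :
    MemLp (PopEFun L lam a Ω Ω₁ p) 2 (μw L) ∧
      Real.sqrt (∫ y, (L ^ 2 + y ^ 2) * PopEFun L lam a Ω Ω₁ p y ^ 2) ≤
        2 * (|lam| + B₀ + |a| * Real.sqrt (π / (4 * L)) * Real.sqrt (∫ y, (L ^ 2 + y ^ 2) * Ω₁ y ^ 2)) * ‖p‖ := by
  obtain ⟨-, -, -, h0, -, -, -⟩ := profileE_of_mem hL p
  obtain ⟨huc, -, -, -⟩ := basicE_of_mem hL p
  obtain ⟨hHm, -, hwH, hiso⟩ := hilbertE_of_mem hL p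
  obtain ⟨hUc, hU⟩ := covariantVelocityE_of_mem hL p
  set sU : ℝ := Real.sqrt (∫ y, (L ^ 2 + y ^ 2) * profile p y ^ 2) with hsU
  have hsU0 : 0 ≤ sU := Real.sqrt_nonneg _
  have hsUle : sU ≤ 2 * ‖p‖ := (sqrt_weights_le hL p).1
  have hP0 : 0 ≤ Real.sqrt (π / (4 * L)) := Real.sqrt_nonneg _
  -- piece 1: λχδ
  set f₁ : ℝ → ℝ := fun ξ => lam * (L ^ 2 / (L ^ 2 + ξ ^ 2)) * profile p ξ with hf₁
  have hf₁m : AEStronglyMeasurable f₁ volume := by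
    have : Continuous f₁ := by
      refine (continuous_const.mul (continuous_const.div (by fun_prop) fun ξ => ?_)).mul huc
      positivity
    exact this.aestronglyMeasurable
  obtain ⟨hf₁i, hf₁b⟩ := weightedSq_le_of_sq_le (L := L) (C := |lam|) hf₁m h0 (abs_nonneg _) fun ξ => by
    have hχ0 : 0 ≤ L ^ 2 / (L ^ 2 + ξ ^ 2) := by positivity
    have hχ1 : L ^ 2 / (L ^ 2 + ξ ^ 2) ≤ 1 := by
      rw [div_le_one (by positivity)]; nlinarith [sq_nonneg ξ]
    have : (lam * (L ^ 2 / (L ^ 2 + ξ ^ 2))) ^ 2 ≤ |lam| ^ 2 := by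
      rw [mul_pow, sq_abs]
      have hχ2 : (L ^ 2 / (L ^ 2 + ξ ^ 2)) ^ 2 ≤ 1 := by nlinarith
      nlinarith [sq_nonneg lam]
    calc f₁ ξ ^ 2 = (lam * (L ^ 2 / (L ^ 2 + ξ ^ 2))) ^ 2 * profile p ξ ^ 2 := by rw [hf₁]; ring
      _ ≤ |lam| ^ 2 * profile p ξ ^ 2 := mul_le_mul_of_nonneg_right this (sq_nonneg _)
  -- piece 2: Ω̄·Hδ
  set f₂ : ℝ → ℝ := fun ξ => Ω ξ * hilbertTransform (profile p) ξ with hf₂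
  have hf₂m : AEStronglyMeasurable f₂ volume := hΩm.mul hHm
  obtain ⟨hf₂i, hf₂b⟩ := weightedSq_le_of_sq_le (L := L) (C := B₀) hf₂m hwH hB₀ fun ξ => by
    have h2 : Ω ξ ^ 2 ≤ B₀ ^ 2 := by rw [← sq_abs (Ω ξ)]; exact pow_le_pow_left₀ (abs_nonneg _) (hΩb ξ) 2
    calc f₂ ξ ^ 2 = Ω ξ ^ 2 * hilbertTransform (profile p) ξ ^ 2 := by rw [hf₂]; ring
      _ ≤ B₀ ^ 2 * hilbertTransform (profile p) ξ ^ 2 := mul_le_mul_of_nonneg_right h2 (sq_nonneg _)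
  -- piece 3: aΩ̄₁𝒰⁺δ
  set f₃ : ℝ → ℝ := fun ξ => a * Ω₁ ξ * ∫ s in Iic ξ, hilbertTransform (profile p) s with hf₃
  have hf₃m : AEStronglyMeasurable f₃ volume := (hΩ₁m.const_mul a).mul hUc.aestronglyMeasurable
  obtain ⟨hf₃i, hf₃b⟩ := weightedSq_le_of_sq_le (L := L) (C := |a| * (Real.sqrt (π / (4 * L)) * sU)) hf₃m hwΩ₁ (by positivity)
    fun ξ => by
    have h3 : (a * ∫ s in Iic ξ, hilbertTransform (profile p) s) ^ 2 ≤ (|a| * (Real.sqrt (π / (4 * L)) * sU)) ^ 2 := by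
      rw [← sq_abs (a * _), abs_mul]
      exact pow_le_pow_left₀ (by positivity) (mul_le_mul_of_nonneg_left (hU ξ) (abs_nonneg a)) 2
    calc f₃ ξ ^ 2 = (a * ∫ s in Iic ξ, hilbertTransform (profile p) s) ^ 2 * Ω₁ ξ ^ 2 := by rw [hf₃]; ring
      _ ≤ (|a| * (Real.sqrt (π / (4 * L)) * sU)) ^ 2 * Ω₁ ξ ^ 2 := mul_le_mul_of_nonneg_right h3 (sq_nonneg _)
  -- assemble
  have e : PopEFun L lam a Ω Ω₁ p = fun ξ => (f₁ ξ + f₂ ξ) - f₃ ξ := by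
    funext ξ; simp only [PopEFun, hf₁, hf₂, hf₃]
  have hm₁ := memLp_W hf₁m hf₁i; have hm₂ := memLp_W hf₂m hf₂i; have hm₃ := memLp_W hf₃m hf₃i
  have hmem : MemLp (PopEFun L lam a Ω Ω₁ p) 2 (μw L) := by rw [e]; exact (hm₁.add hm₂).sub hm₃
  refine ⟨hmem, ?_⟩
  have hn := (norm_toLp_W hL hmem).2
  have hsum : (hmem.toLp (PopEFun L lam a Ω Ω₁ p) : W L) = hm₁.toLp f₁ + hm₂.toLp f₂ - hm₃.toLp f₃ := by
    rw [← MemLp.toLp_add, ← MemLp.toLp_sub]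
    exact MemLp.toLp_congr _ _ (Eventually.of_forall fun ξ => by rw [e]; rfl)
  rw [← hn, hsum]
  have hn₁ := (norm_toLp_W hL hm₁).2; have hn₂ := (norm_toLp_W hL hm₂).2; have hn₃ := (norm_toLp_W hL hm₃).2
  have hwΩ₁0 : 0 ≤ Real.sqrt (∫ y, (L ^ 2 + y ^ 2) * Ω₁ y ^ 2) := Real.sqrt_nonneg _
  calc ‖(hm₁.toLp f₁ + hm₂.toLp f₂ - hm₃.toLp f₃ : W L)‖ ≤ ‖(hm₁.toLp f₁ : W L)‖ + ‖(hm₂.toLp f₂ : W L)‖ + ‖(hm₃.toLp f₃ : W L)‖ :=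
        (norm_sub_le _ _).trans (add_le_add (norm_add_le _ _) le_rfl)
    _ ≤ |lam| * sU + B₀ * Real.sqrt (∫ y, (L ^ 2 + y ^ 2) * hilbertTransform (profile p) y ^ 2)
          + |a| * (Real.sqrt (π / (4 * L)) * sU) * Real.sqrt (∫ y, (L ^ 2 + y ^ 2) * Ω₁ y ^ 2) := by
        rw [hn₁, hn₂, hn₃]; exact add_le_add (add_le_add hf₁b hf₂b) hf₃b
    _ = (|lam| + B₀ + |a| * Real.sqrt (π / (4 * L)) * Real.sqrt (∫ y, (L ^ 2 + y ^ 2) * Ω₁ y ^ 2)) * sU := by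
        rw [hiso]; ring
    _ ≤ (|lam| + B₀ + |a| * Real.sqrt (π / (4 * L)) * Real.sqrt (∫ y, (L ^ 2 + y ^ 2) * Ω₁ y ^ 2)) * (2 * ‖p‖) :=
        mul_le_mul_of_nonneg_left hsUle (by positivity)
    _ = 2 * (|lam| + B₀ + |a| * Real.sqrt (π / (4 * L)) * Real.sqrt (∫ y, (L ^ 2 + y ^ 2) * Ω₁ y ^ 2)) * ‖p‖ := by ring

/-- `P⁺` is additive on profiles, pointwise (additivity of `H` and `𝒰⁺` on the class). [folklore] -/
theorem PopEFun_add (p q : EspE L hL) :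
    PopEFun L lam a Ω Ω₁ (p + q) = fun ξ => PopEFun L lam a Ω Ω₁ p ξ + PopEFun L lam a Ω Ω₁ q ξ := by
  have hsum := (derE_add hL p q).2
  funext ξ
  obtain ⟨hH, hU⟩ := hilbertE_add hL p q ξ
  simp only [PopEFun]
  rw [hH, hU, hsum]
  ring

/-- `P⁺` is homogeneous on profiles, pointwise. [folklore] -/
theorem PopEFun_smul (c : ℝ) (p : EspE L hL) :
    PopEFun L lam a Ω Ω₁ (c • p) = fun ξ => c * PopEFun L lam a Ω Ω₁ p ξ := by
  have hprof := (derE_smul hL c p).2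
  funext ξ
  obtain ⟨hH, hU⟩ := hilbertE_smul hL c p ξ
  simp only [PopEFun]
  rw [hH, hU, hprof]
  ring

/-- **The even nonlocal part as a bounded operator** `PopE : EspE L hL →L[ℝ] W L`, `p ↦ λχ·δ + Ω̄·Hδ − a·Ω̄₁·𝒰⁺δ` (as an `L²_w` class), for a
bounded a.e.-strongly measurable `Ω̄` and `Ω̄₁` with `∫ w Ω̄₁² < ∞`. [folklore] -/
def PopE : EspE L hL →L[ℝ] W L :=
  LinearMap.mkContinuous
    { toFun := fun p => (memLp_PopEFun hL lam a hΩm hB₀ hΩb hΩ₁m hwΩ₁ p).1.toLp (PopEFun L lam a Ω Ω₁ p)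
      map_add' := fun p q => by
        rw [← MemLp.toLp_add]
        exact MemLp.toLp_congr _ _ (Eventually.of_forall fun ξ => by
          rw [PopEFun_add hL lam a p q]; rfl)
      map_smul' := fun c p => by
        rw [RingHom.id_apply, ← MemLp.toLp_const_smul]
        exact MemLp.toLp_congr _ _ (Eventually.of_forall fun ξ => by
          rw [PopEFun_smul hL lam a c p]; rfl) }
    (2 * (|lam| + B₀ + |a| * Real.sqrt (π / (4 * L)) * Real.sqrt (∫ y, (L ^ 2 + y ^ 2) * Ω₁ y ^ 2)))
    fun p => by
      simp only [LinearMap.coe_mk, AddHom.coe_mk]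
      rw [(norm_toLp_W hL (memLp_PopEFun hL lam a hΩm hB₀ hΩb hΩ₁m hwΩ₁ p).1).2]
      exact (memLp_PopEFun hL lam a hΩm hB₀ hΩb hΩ₁m hwΩ₁ p).2

/-- `PopE p` is the `L²_w` class of the function `P⁺δ`: a.e. equality and the norm bound. [folklore] -/
theorem PopE_apply (p : EspE L hL) :
    (((PopE hL lam a hΩm hB₀ hΩb hΩ₁m hwΩ₁ p : W L) : ℝ → ℝ) =ᵐ[volume] PopEFun L lam a Ω Ω₁ p) ∧
      ‖PopE hL lam a hΩm hB₀ hΩb hΩ₁m hwΩ₁ p‖ ≤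
        2 * (|lam| + B₀ + |a| * Real.sqrt (π / (4 * L)) * Real.sqrt (∫ y, (L ^ 2 + y ^ 2) * Ω₁ y ^ 2)) * ‖p‖ := by
  have h := norm_toLp_W hL (memLp_PopEFun hL lam a hΩm hB₀ hΩb hΩ₁m hwΩ₁ p).1
  refine ⟨h.1, ?_⟩
  show ‖((memLp_PopEFun hL lam a hΩm hB₀ hΩb hΩ₁m hwΩ₁ p).1.toLp (PopEFun L lam a Ω Ω₁ p) : W L)‖ ≤ _
  rw [h.2]; exact (memLp_PopEFun hL lam a hΩm hB₀ hΩb hΩ₁m hwΩ₁ p).2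

end PopE

/-! ### §2b `P⁺` at a centre of record shape -/

section Centre

variable {L : ℝ} (hL : 0 < L) (lam a : ℝ) {Ω Ω₁ : ℝ → ℝ} {H₀ : ℝ} (hc : IsCentre L Ω Ω₁ H₀)

/-- **The even `P⁺` at the centre `Ω̄`**: `PopCE = PopE` with `B₀ = (√2/L)‖Ω̄‖_E` (the (E4) sup bound of the centre), the even companion of
`SheetRCertificateAssembly.PopC`. [folklore] -/
def PopCE : EspE L hL →L[ℝ] W L :=
  PopE hL lam a (hc.basic hL).1.aestronglyMeasurable (by positivity) (hc.basic hL).2.2.2.2 hc.measurable hc.weight₁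

/-- `PopCE p` is the `L²_w` class of `P⁺δ = λχδ + Ω̄·Hδ − aΩ̄₁·𝒰⁺δ`, `δ = profile p`. [folklore] -/
theorem PopCE_apply (p : EspE L hL) : (((PopCE hL lam a hc p : W L)) : ℝ → ℝ) =ᵐ[volume] PopEFun L lam a Ω Ω₁ p :=
  (PopE_apply hL lam a (hc.basic hL).1.aestronglyMeasurable (by positivity) (hc.basic hL).2.2.2.2 hc.measurable hc.weight₁ p).1

end Centre

end SheetREvenAssemblyOperators
end Summit.NavierStokesRegularity.OSWSelfSimilar

end
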